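import Mathlib
import Summits.KontsevichZagierPeriods.KontsevichZagierPeriods.Theorems.SymplecticScissorsVolumeFormOffPlaneSlackMergeAux
import Literature.NumberTheory.Transcendental.KZProductIdeal
import Literature.NumberTheory.Transcendental.KZDominatedFamilyRelations

/-!
# `VolumeFormOffPlane` (stmt-KontsevichZagierPeriods-14935) — line `Sketch`,
stub `stub_slackMerge` (the toric encoding is multiplicative:
`[cell_C] · [cell_D] ≡ [cell_{C×D}]`)

Toric cells: for `C ⊆ ℝ^p` (in the open positive orthant) the cell
`cell_C = {(x, z) ∈ ℝ^p × ℝ | x ∈ C, 0 < z, z · ∏ x < 1}`. The product representation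
`[cell_C, 1] · [cell_D, 1] = [cell_C × cell_D, 1]` (coordinates `(x, z, y, w)`, two slacks) is
congruent modulo the moves of the Kontsevich–Zagier calculus to the merged cell
`[cell_{C × D}, 1]` (coordinates `(x, y, z')`, one slack). Four moves:

1. reindex `(x, z, y, w) ↦ (x, y, z, w)` (a coordinate permutation, rule (2) with `|det| = 1`,
   `KZ.of_sub_of_reindex_mem_relations`);
2. the change of variables `Φ (x, y, z, w) = (x, y, z / ∏ y, w · ∏ y)` (rule (2)): its Jacobian
   is lower triangular with diagonal `(1, …, 1, 1/∏ y, ∏ y)`, so `det Φ' = 1`; it maps the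
   reindexed product cell onto the open slab `{(v, w') | v ∈ cell_{C×D}, 0 < w' < 1}`;
3. the open slab is a co-null restriction of the closed slab `cell_{C×D} × [0, 1]`
   (rule (1a), `KZ.IntegralRep.of_sub_of_restrict_mem_relations`);
4. Newton–Leibniz along the last coordinate collapses the closed slab onto `cell_{C×D}`
   (rule (3), `KZ.IntegralRep.of_slab_sub_of_mem_newtonLeibnizRel`).

All intermediate integrands are `1`, so no integrability estimate beyond the given ones is needed.

Sources: M. Kontsevich, D. Zagier, *Periods* (2001), §1.2 rules (1)–(3), §4.1 (Fubini);
J. Bochnak, M. Coste, M.-F. Roy, *Real Algebraic Geometry* (1998), §2.2. The Jacobian bookkeeping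
is folklore; the rule-(2) witness follows the landed sibling
`…/Theorems/SymplecticScissorsVolumeFormOffPlaneCumprodMove.lean`.
-/

noncomputable section

open MeasureTheory Set MvPolynomial
open Literature.NumberTheory.Transcendental Literature.ModelTheory.ExponentialFields

namespace Summit.KontsevichZagierPeriods.SymplecticScissors.LogPolytope

/-! ## The stub -/

/-- **The slack merge** (stub `stub_slackMerge` of `VolumeFormOffPlane`, line `Sketch`,
stmt-KontsevichZagierPeriods-14935): the toric encoding is multiplicative modulo the moves,
`[cell_C, 1] · [cell_D, 1] − [cell_{C×D}, 1] ∈ KZ.relations`. The product representation (two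
slacks, coordinates `(x, z, y, w)`) is reindexed to `(x, y, z, w)` (rule (2), a permutation),
carried by the chart `(x, y, z, w) ↦ (x, y, z/∏y, w ∏y)` (rule (2), Jacobian determinant `1`) onto
the open slab `cell_{C×D} × (0, 1)`, which is a co-null restriction of the closed slab
`cell_{C×D} × [0, 1]` (rule (1a)), and the closed slab collapses onto `cell_{C×D}` by
Newton–Leibniz along the last coordinate (rule (3)).
[Kontsevich–Zagier 2001, §1.2 rules (1)–(3), §4.1] [folklore] -/
theorem stub_slackMerge : ∀ (p q : ℕ) (C : Set (Fin p → ℝ)) (D : Set (Fin q → ℝ))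
    (r : KZ.IntegralRep (p + 1)) (s : KZ.IntegralRep (q + 1)) (t : KZ.IntegralRep (p + q + 1)),
    Literature.ModelTheory.ExponentialFields.IsSemialgebraic ℚ C →
    Literature.ModelTheory.ExponentialFields.IsSemialgebraic ℚ D →
    (∀ x ∈ C, ∀ ι, 0 < x ι) → (∀ y ∈ D, ∀ κ, 0 < y κ) →
    r.domain = {w : Fin (p + 1) → ℝ | (fun ι : Fin p => w (Fin.castSucc ι)) ∈ C ∧
      0 < w (Fin.last p) ∧ w (Fin.last p) * ∏ ι : Fin p, w (Fin.castSucc ι) < 1} →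
    s.domain = {w : Fin (q + 1) → ℝ | (fun κ : Fin q => w (Fin.castSucc κ)) ∈ D ∧
      0 < w (Fin.last q) ∧ w (Fin.last q) * ∏ κ : Fin q, w (Fin.castSucc κ) < 1} →
    t.domain = {w : Fin (p + q + 1) → ℝ |
      (fun ι : Fin p => w (Fin.castSucc (Fin.castAdd q ι))) ∈ C ∧
      (fun κ : Fin q => w (Fin.castSucc (Fin.natAdd p κ))) ∈ D ∧
      0 < w (Fin.last (p + q)) ∧ w (Fin.last (p + q)) * ∏ j : Fin (p + q), w (Fin.castSucc j) < 1} →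
    (∀ w ∈ r.domain, r.integrand w = 1) → (∀ w ∈ s.domain, s.integrand w = 1) →
    (∀ w ∈ t.domain, t.integrand w = 1) →
    KZ.of r * KZ.of s - KZ.of t ∈ KZ.relations := by
  intro p q C D r s t _hC _hD _hC0 hD0 hr hs ht hr1 hs1 ht1
  classical
  -- the product `P = ∏ y`, the chart `Φ` and its inverse `Ψ` in the coordinates `(x, y, z, w)`
  obtain ⟨P, hP⟩ : ∃ P : (Fin (p + q + 1 + 1) → ℝ) → ℝ,
      ∀ v, P v = ∏ κ, v (Fin.castSucc (Fin.castSucc (Fin.natAdd p κ))) := ⟨_, fun _ => rfl⟩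
  obtain ⟨Φ, hΦb, hΦz, hΦw⟩ : ∃ Φ : (Fin (p + q + 1 + 1) → ℝ) → (Fin (p + q + 1 + 1) → ℝ),
      (∀ v (j : Fin (p + q)), Φ v (Fin.castSucc (Fin.castSucc j)) =
        v (Fin.castSucc (Fin.castSucc j))) ∧
      (∀ v, Φ v (Fin.castSucc (Fin.last (p + q))) =
        v (Fin.castSucc (Fin.last (p + q))) * (P v)⁻¹) ∧
      ∀ v, Φ v (Fin.last (p + q + 1)) = v (Fin.last (p + q + 1)) * P v :=
    ⟨fun v => Fin.snoc (α := fun _ => ℝ) (Fin.snoc (α := fun _ => ℝ)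
        (fun j : Fin (p + q) => v (Fin.castSucc (Fin.castSucc j)))
        (v (Fin.castSucc (Fin.last (p + q))) * (P v)⁻¹)) (v (Fin.last (p + q + 1)) * P v),
      fun v j => by simp only [Fin.snoc_castSucc],
      fun v => by simp only [Fin.snoc_castSucc, Fin.snoc_last],
      fun v => by simp only [Fin.snoc_last]⟩
  obtain ⟨Ψ, hΨb, hΨz, hΨw⟩ : ∃ Ψ : (Fin (p + q + 1 + 1) → ℝ) → (Fin (p + q + 1 + 1) → ℝ),
      (∀ v (j : Fin (p + q)), Ψ v (Fin.castSucc (Fin.castSucc j)) =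
        v (Fin.castSucc (Fin.castSucc j))) ∧
      (∀ v, Ψ v (Fin.castSucc (Fin.last (p + q))) =
        v (Fin.castSucc (Fin.last (p + q))) * P v) ∧
      ∀ v, Ψ v (Fin.last (p + q + 1)) = v (Fin.last (p + q + 1)) * (P v)⁻¹ :=
    ⟨fun v => Fin.snoc (α := fun _ => ℝ) (Fin.snoc (α := fun _ => ℝ)
        (fun j : Fin (p + q) => v (Fin.castSucc (Fin.castSucc j)))
        (v (Fin.castSucc (Fin.last (p + q))) * P v)) (v (Fin.last (p + q + 1)) * (P v)⁻¹),
      fun v j => by simp only [Fin.snoc_castSucc],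
      fun v => by simp only [Fin.snoc_castSucc, Fin.snoc_last],
      fun v => by simp only [Fin.snoc_last]⟩
  obtain ⟨hPΦ, hPΨ, hΨΦ, hΦΨ⟩ := sm_inverse (Fin.natAdd p) P hP Φ Ψ hΦb hΦz hΦw hΨb hΨz hΨw
  obtain ⟨Φ', hΦ'⟩ := sm_hasFDerivAt (Fin.natAdd p) P hP Φ hΦb hΦz hΦw
  obtain ⟨e, he1, he2, he3, he4⟩ := sm_exists_perm p q
  have hPpos : ∀ v : Fin (p + q + 1 + 1) → ℝ,
      (fun κ : Fin q => v (Fin.castSucc (Fin.castSucc (Fin.natAdd p κ)))) ∈ D → 0 < P v :=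
    fun v hv => by
      rw [hP]
      exact Finset.prod_pos fun κ _ => hD0 _ hv κ
  -- the reindexed product representation and its domain
  have hρmem : ∀ v : Fin (p + q + 1 + 1) → ℝ, v ∈ ((r.prod s).reindex e).domain ↔
      ((fun ι : Fin p => v (Fin.castSucc (Fin.castSucc (Fin.castAdd q ι)))) ∈ C ∧
        0 < v (Fin.castSucc (Fin.last (p + q))) ∧
        v (Fin.castSucc (Fin.last (p + q))) *
          ∏ ι : Fin p, v (Fin.castSucc (Fin.castSucc (Fin.castAdd q ι))) < 1) ∧
      ((fun κ : Fin q => v (Fin.castSucc (Fin.castSucc (Fin.natAdd p κ)))) ∈ D ∧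
        0 < v (Fin.last (p + q + 1)) ∧
        v (Fin.last (p + q + 1)) *
          ∏ κ : Fin q, v (Fin.castSucc (Fin.castSucc (Fin.natAdd p κ))) < 1) := by
    intro v
    simp only [KZ.IntegralRep.reindex_domain, KZ.IntegralRep.prod_domain,
      KZ.IntegralRep.mem_prodDomain, mem_setOf_eq, hr, hs, he1, he2, he3, he4]
  -- the open slab over `t.domain`
  obtain ⟨E, hE_def⟩ : ∃ E : Set (Fin (p + q + 1 + 1) → ℝ),
      E = {v | (Fin.init v : Fin (p + q + 1) → ℝ) ∈ t.domain ∧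
        0 < v (Fin.last (p + q + 1)) ∧ v (Fin.last (p + q + 1)) < 1} := ⟨_, rfl⟩
  have hEmem : ∀ v : Fin (p + q + 1 + 1) → ℝ, v ∈ E ↔
      ((fun ι : Fin p => v (Fin.castSucc (Fin.castSucc (Fin.castAdd q ι)))) ∈ C ∧
        (fun κ : Fin q => v (Fin.castSucc (Fin.castSucc (Fin.natAdd p κ)))) ∈ D ∧
        0 < v (Fin.castSucc (Fin.last (p + q))) ∧
        v (Fin.castSucc (Fin.last (p + q))) *
          ∏ j : Fin (p + q), v (Fin.castSucc (Fin.castSucc j)) < 1) ∧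
      0 < v (Fin.last (p + q + 1)) ∧ v (Fin.last (p + q + 1)) < 1 := by
    intro v
    simp only [hE_def, mem_setOf_eq, ht, Fin.init]
  have hE : IsSemialgebraic ℚ E := by
    have h1 : IsSemialgebraic ℚ
        {v : Fin (p + q + 1 + 1) → ℝ | 0 < v (Fin.last (p + q + 1))} := by
      simpa using isSemialgebraic_setOf_eval_pos (k := ℚ) (R := ℝ)
        (X (Fin.last (p + q + 1)) : MvPolynomial (Fin (p + q + 1 + 1)) ℚ)
    have h2 : IsSemialgebraic ℚ
        {v : Fin (p + q + 1 + 1) → ℝ | v (Fin.last (p + q + 1)) < 1} := by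
      simpa using isSemialgebraic_setOf_eval_lt (k := ℚ) (R := ℝ)
        (X (Fin.last (p + q + 1)) : MvPolynomial (Fin (p + q + 1 + 1)) ℚ) 1
    rw [hE_def]
    convert (t.isSemialgebraic_domain.setOf_init_mem.inter h1).inter h2 using 1
    ext v
    simp only [mem_setOf_eq, mem_inter_iff, and_assoc]
  have hEsub : E ⊆ (t.slab 0).domain := fun v hv => by
    rw [hE_def] at hv
    simp only [KZ.IntegralRep.domain_slab, KZ.IntegralRep.slabDomain, mem_setOf_eq,
      Nat.cast_zero, zero_add]
    exact ⟨hv.1, hv.2.1.le, hv.2.2.le⟩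
  have hvol : volume ((t.slab 0).domain \ E) = 0 := by
    refine measure_mono_null (fun v hv => ?_)
      (measure_union_null (KZ.volume_setOf_last_eq_zero (n := p + q + 1) 0)
        (KZ.volume_setOf_last_eq_zero (n := p + q + 1) 1))
    rw [hE_def, mem_sdiff, KZ.IntegralRep.domain_slab] at hv
    simp only [KZ.IntegralRep.slabDomain, mem_setOf_eq, Nat.cast_zero, zero_add, not_and,
      not_lt] at hv
    obtain ⟨⟨hinit, h0, h1⟩, hnot⟩ := hv
    rw [mem_union, mem_setOf_eq, mem_setOf_eq]
    rcases h0.lt_or_eq with hpos | hzero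
    · exact Or.inr (le_antisymm h1 (hnot hinit hpos))
    · exact Or.inl hzero.symm
  -- the image of the chart
  have himage :
      ((t.slab 0).restrict E hE hEsub).domain = Φ '' ((r.prod s).reindex e).domain := by
    rw [KZ.IntegralRep.domain_restrict]
    ext u
    rw [hEmem, mem_image]
    constructor
    · rintro ⟨⟨hxC, hyD, hz0, hz1⟩, hw0, hw1⟩
      have hP0 : 0 < P u := hPpos u hyD
      refine ⟨Ψ u, (hρmem _).mpr ⟨⟨?_, ?_, ?_⟩, ?_, ?_, ?_⟩, hΦΨ u hP0.ne'⟩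
      · simpa only [hΨb] using hxC
      · rw [hΨz]
        exact mul_pos hz0 hP0
      · simp only [hΨb, hΨz]
        rw [Fin.prod_univ_add, ← hP u] at hz1
        rw [mul_assoc, mul_comm (P u)]
        exact hz1
      · simpa only [hΨb] using hyD
      · rw [hΨw]
        exact mul_pos hw0 (inv_pos.mpr hP0)
      · simp only [hΨb, hΨw]
        rw [← hP u, inv_mul_cancel_right₀ hP0.ne']
        exact hw1
    · rintro ⟨v, hv, rfl⟩
      obtain ⟨⟨hxC, hz0, hz1⟩, hyD, hw0, hw1⟩ := (hρmem v).mp hv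
      have hP0 : 0 < P v := hPpos v hyD
      refine ⟨⟨?_, ?_, ?_, ?_⟩, ?_, ?_⟩
      · simpa only [hΦb] using hxC
      · simpa only [hΦb] using hyD
      · rw [hΦz]
        exact mul_pos hz0 (inv_pos.mpr hP0)
      · simp only [hΦb, hΦz]
        rw [Fin.prod_univ_add, ← hP v, mul_comm _ (P v), ← mul_assoc,
          inv_mul_cancel_right₀ hP0.ne']
        exact hz1
      · rw [hΦw]
        exact mul_pos hw0 hP0
      · rw [hΦw, hP]
        exact hw1
  -- the four moves
  have h1 : KZ.of (r.prod s) - KZ.of ((r.prod s).reindex e) ∈ KZ.relations :=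
    KZ.of_sub_of_reindex_mem_relations _ e
  have h2 : KZ.of ((r.prod s).reindex e) - KZ.of ((t.slab 0).restrict E hE hEsub) ∈
      KZ.relations := by
    refine KZ.changeOfVariablesRel_subset_relations ⟨p + q + 1 + 1, (r.prod s).reindex e,
      (t.slab 0).restrict E hE hEsub, Φ, Φ', ?_, ?_, ?_, himage, ?_, rfl⟩
    · exact sm_isSemialgebraicMapOn (Fin.natAdd p) P hP Φ hΦb hΦz hΦw
        ((r.prod s).reindex e).isSemialgebraic_domain
        fun v hv => (hPpos v ((hρmem v).mp hv).2.1).ne'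
    · intro v hv
      exact (hΦ' v (hPpos v ((hρmem v).mp hv).2.1).ne').1.hasFDerivWithinAt
    · intro v hv v' hv' h
      rw [← hΨΦ v (hPpos v ((hρmem v).mp hv).2.1).ne',
        ← hΨΦ v' (hPpos v' ((hρmem v').mp hv').2.1).ne', h]
    · intro v hv
      have hyD := ((hρmem v).mp hv).2.1
      have hΦv : Φ v ∈ ((t.slab 0).restrict E hE hEsub).domain :=
        himage ▸ mem_image_of_mem Φ hv
      rw [KZ.IntegralRep.domain_restrict, hE_def] at hΦv
      have hvr : (fun i => v (e (Fin.castAdd (q + 1) i))) ∈ r.domain ∧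
          (fun j => v (e (Fin.natAdd (p + 1) j))) ∈ s.domain := by
        simpa only [KZ.IntegralRep.reindex_domain, KZ.IntegralRep.prod_domain,
          KZ.IntegralRep.mem_prodDomain, mem_setOf_eq] using hv
      rw [(hΦ' v (hPpos v hyD).ne').2, abs_one, mul_one]
      simp only [KZ.IntegralRep.reindex_integrand, KZ.IntegralRep.prod_integrand_eq,
        KZ.IntegralRep.prodFun_apply, KZ.IntegralRep.integrand_restrict,
        KZ.IntegralRep.integrand_slab]
      rw [hr1 _ hvr.1, hs1 _ hvr.2, ht1 _ hΦv.1, one_mul]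
  have h3 : KZ.of (t.slab 0) - KZ.of ((t.slab 0).restrict E hE hEsub) ∈ KZ.relations :=
    KZ.IntegralRep.of_sub_of_restrict_mem_relations _ hE hEsub hvol
  have h4 : KZ.of (t.slab 0) - KZ.of t ∈ KZ.relations :=
    KZ.newtonLeibnizRel_subset_relations (KZ.IntegralRep.of_slab_sub_of_mem_newtonLeibnizRel t 0)
  rw [KZ.of_mul_of]
  have : KZ.of (r.prod s) - KZ.of t = (KZ.of (r.prod s) - KZ.of ((r.prod s).reindex e)) +
      (KZ.of ((r.prod s).reindex e) - KZ.of ((t.slab 0).restrict E hE hEsub)) -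
      (KZ.of (t.slab 0) - KZ.of ((t.slab 0).restrict E hE hEsub)) +
      (KZ.of (t.slab 0) - KZ.of t) := by abel
  rw [this]
  exact KZ.relations.add_mem (KZ.relations.sub_mem (KZ.relations.add_mem h1 h2) h3) h4

end Summit.KontsevichZagierPeriods.SymplecticScissors.LogPolytope

end
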